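import Summits.QuantumFields.QCD.Theses.SpectralDefectExtinction
import Literature.MathematicalPhysics.QuantumFieldTheory.QCDPhaseQuenched
import Literature.MathematicalPhysics.QuantumFieldTheory.SpectralDefectDensity
import Literature.Barriers.QuantumFields.WilsonDeterminantMassSplitting
import Literature.MathematicalPhysics.QuantumFieldTheory.WilsonEnergyConvexity
import Summits.QuantumFields.QCD.Theorems.SpectralDefectExtinctionWegnerEstimateStubGlueHaar
import Summits.QuantumFields.QCD.Theorems.SpectralDefectExtinctionWegnerEstimateStubUntilt

/-!
# Stub `cellAverageBound` of line `Sketch` (skeleton "ResolventCell") for crux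
`SpectralDefectExtinction.WegnerEstimate` (item stmt-QuantumFields-8966)

GIVEN the glueing identity (`hglue`) and the abstract untilt (`huntilt`), the Wilson expectation of a
continuous `g ≥ 0` is at most `C (1 + β^p)` times the supremum over exteriors `U` of the Haar average of
`g` over the links of the cell `x + box 4 R` glued into `U`.  Proof: `∫ g dμ_β = (∫ g w dπ) / Z`,
`w = e^{-βS}`, `π = Haar^{⊗E}` (`wilsonExpectation_eq_integral_div`); the glueing map pushes `π ⊗ π` to
`π`, so `∫ F dπ = ∫_U ∫_V F (glue U V)` (`integral_map`, `integral_prod`); for a fixed exterior the glued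
action depends on the `4(2R+1)^4` cell links only and is `960`-Lipschitz along the one-link circles
`s ↦ W[e ↦ A T(s) B]`, `T(s) = diag(e^{is}, e^{-is}, 1)` (shadow of one link: `≤ 80` plaquettes, each
`12`-Lipschitz — the argument of the landed `CircleTransport.stub_actionLipschitz`, valid for every `L`),
so the untilt gives `w (glue U V) ≤ C₀ (1+β)^{p₀} ∫_V w ∘ glue U`; integrate against `g ≥ 0`, use the
hypothesis, integrate in `U`; finally `(1+β)^{p₀} ≤ 2^{p₀} (1 + β^{p₀})` (`β ≥ 1`).  Source: E. Seiler,
LNP 159 (1982) Ch. 1 (bounded smooth plaquette terms); standard measure theory. -/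

noncomputable section

namespace Summit.QuantumFields.QCD.Cruxes.WegnerEstimate.ResolventCell

open MeasureTheory
open scoped Matrix BigOperators Matrix.Norms.L2Operator
open Literature.MathematicalPhysics.QuantumLattice Literature.MathematicalPhysics.QuantumFieldTheory
  Literature.Probability.LatticeModels
open Matrix

/-- `diag(e^{iθ}, e^{-iθ}, 1) ∈ SU(3)`: unitary with determinant one. -/
theorem cellAverage_diagCircle_mem (θ : ℝ) :
    Matrix.diagonal ![Complex.exp (θ * Complex.I), Complex.exp (-(θ * Complex.I)), 1] ∈
      Matrix.specialUnitaryGroup (Fin 3) ℂ := by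
  have hmul : ∀ x : ℝ, Complex.exp (x * Complex.I) * star (Complex.exp (x * Complex.I)) = 1 := by
    intro x
    rw [Complex.star_def, Complex.mul_conj, Complex.normSq_eq_norm_sq, Complex.norm_exp_ofReal_mul_I]
    simp
  have hneg : ∀ x : ℝ, Complex.exp (-(x * Complex.I)) = Complex.exp ((-x : ℝ) * Complex.I) := by
    intro x; push_cast; ring_nf
  rw [Matrix.mem_specialUnitaryGroup_iff, Matrix.mem_unitaryGroup_iff]
  constructor
  · rw [Matrix.star_eq_conjTranspose, Matrix.diagonal_conjTranspose,
      Matrix.diagonal_mul_diagonal, ← Matrix.diagonal_one]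
    congr 1
    funext i
    fin_cases i
    · simpa using hmul θ
    · simpa [hneg] using hmul (-θ)
    · simp
  · rw [Matrix.det_diagonal, Fin.prod_univ_three]
    simp [← Complex.exp_add]

/-- **The diagonal circle exists** as a family `T : ℝ → SU(3)` with `T(θ) = diag(e^{iθ}, e^{-iθ}, 1)`. -/
theorem cellAverage_exists_diagCircle :
    ∃ T : ℝ → SU3, ∀ θ : ℝ, ((T θ : SU3) : Matrix (Fin 3) (Fin 3) ℂ) =
      Matrix.diagonal ![Complex.exp (θ * Complex.I), Complex.exp (-(θ * Complex.I)), 1] :=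
  ⟨fun θ => ⟨_, cellAverage_diagCircle_mem θ⟩, fun _ => rfl⟩

/-- The diagonal circle is `1`-Lipschitz in the `L²` operator norm: `‖T(s) - T(s')‖ ≤ |s - s'|`. -/
theorem cellAverage_norm_circle_sub_le (T : ℝ → SU3)
    (hT : ∀ θ : ℝ, ((T θ : SU3) : Matrix (Fin 3) (Fin 3) ℂ) =
      Matrix.diagonal ![Complex.exp (θ * Complex.I), Complex.exp (-(θ * Complex.I)), 1])
    (s s' : ℝ) : ‖((T s : SU3) : Matrix (Fin 3) (Fin 3) ℂ) - (T s' : SU3)‖ ≤ |s - s'| := by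
  have hlip : ∀ x y : ℝ, ‖Complex.exp (x * Complex.I) - Complex.exp (y * Complex.I)‖ ≤ |x - y| := by
    intro x y
    have h : Complex.exp (x * Complex.I) - Complex.exp (y * Complex.I) =
        Complex.exp (y * Complex.I) * (Complex.exp (Complex.I * ((x - y : ℝ) : ℂ)) - 1) := by
      rw [mul_sub, mul_one, ← Complex.exp_add]
      congr 1
      push_cast
      ring_nf
    rw [h, norm_mul, Complex.norm_exp_ofReal_mul_I, one_mul]
    exact (Real.norm_exp_I_mul_ofReal_sub_one_le).trans (le_of_eq (Real.norm_eq_abs _))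
  rw [hT, hT, Matrix.diagonal_sub, Matrix.l2_opNorm_diagonal]
  refine (pi_norm_le_iff_of_nonneg (abs_nonneg _)).2 fun k => ?_
  fin_cases k
  · simpa using hlip s s'
  · have h := hlip (-s) (-s')
    rw [show -s - -s' = -(s - s') by ring, abs_neg] at h
    simpa using h
  · simp

/-- `|Re tr M - Re tr M'| ≤ 3 ‖M - M'‖` for `3 × 3` complex matrices in the `L²` operator norm
(entries are bounded by the operator norm). -/
theorem cellAverage_abs_re_trace_sub_le (M M' : Matrix (Fin 3) (Fin 3) ℂ) :
    |M.trace.re - M'.trace.re| ≤ 3 * ‖M - M'‖ := by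
  have hent : ∀ (A : Matrix (Fin 3) (Fin 3) ℂ) (a : Fin 3), ‖A a a‖ ≤ ‖A‖ := by
    intro A a
    have h := Matrix.l2_opNorm_mulVec A (EuclideanSpace.single a (1 : ℂ))
    rw [PiLp.norm_single, norm_one, mul_one] at h
    refine le_trans ?_ h
    have h2 := PiLp.norm_apply_le
      ((EuclideanSpace.equiv (Fin 3) ℂ).symm (A.mulVec (EuclideanSpace.single a (1 : ℂ)))) a
    have h3 : ((EuclideanSpace.equiv (Fin 3) ℂ).symm
        (A.mulVec (EuclideanSpace.single a (1 : ℂ)))) a = A a a := by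
      rw [PiLp.coe_symm_continuousLinearEquiv, PiLp.toLp_apply, PiLp.ofLp_single,
        Matrix.mulVec_single_one]
      rfl
    rwa [h3] at h2
  rw [← Complex.sub_re, ← Matrix.trace_sub]
  refine (Complex.abs_re_le_norm _).trans ?_
  rw [Matrix.trace, Fin.sum_univ_three, Matrix.diag_apply, Matrix.diag_apply, Matrix.diag_apply]
  refine (norm_add₃_le).trans ?_
  linarith [hent (M - M') 0, hent (M - M') 1, hent (M - M') 2]

/-- Replacing the variable `g` on one link `e` by `g'` moves (the fundamental representation of)
every plaquette holonomy by at most `4 ‖g - g'‖` (telescoping in the C⋆-norm, unitary factors). -/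
theorem cellAverage_norm_holonomy_update_sub_le {L : ℕ} (U : GaugeConfig 4 L SU3) (e : Edge 4 L)
    (g g' : SU3) (x : Site 4 L) (i j : Fin 4) :
    ‖(fundamentalRep (Fin 3)) (plaquetteHolonomy (Function.update U e g) x i j) -
        (fundamentalRep (Fin 3)) (plaquetteHolonomy (Function.update U e g') x i j)‖ ≤
      4 * ‖(g : Matrix (Fin 3) (Fin 3) ℂ) - (g' : SU3)‖ := by
  -- telescoping `‖abcd - a'b'c'd'‖ ≤ ‖a - a'‖ + ‖b - b'‖ + ‖c - c'‖ + ‖d - d'‖` for unitaries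
  have htel : ∀ {a b c d a' b' c' d' : Matrix (Fin 3) (Fin 3) ℂ},
      b ∈ unitary _ → c ∈ unitary _ → d ∈ unitary _ → a' ∈ unitary _ → b' ∈ unitary _ →
      c' ∈ unitary _ →
      ‖a * b * c * d - a' * b' * c' * d'‖ ≤ ‖a - a'‖ + ‖b - b'‖ + ‖c - c'‖ + ‖d - d'‖ := by
    intro a b c d a' b' c' d' hb hc hd ha' hb' hc'
    have h : a * b * c * d - a' * b' * c' * d' = (a - a') * b * c * d + a' * (b - b') * c * d +
        a' * b' * (c - c') * d + a' * b' * c' * (d - d') := by noncomm_ring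
    rw [h]
    refine (norm_add_le _ _).trans (add_le_add ((norm_add₃_le).trans (le_of_eq ?_)) (le_of_eq ?_))
    · rw [CStarRing.norm_mul_mem_unitary _ hd, CStarRing.norm_mul_mem_unitary _ hc,
        CStarRing.norm_mul_mem_unitary _ hb, CStarRing.norm_mul_mem_unitary _ hd,
        CStarRing.norm_mul_mem_unitary _ hc, CStarRing.norm_mem_unitary_mul _ ha',
        CStarRing.norm_mul_mem_unitary _ hd, CStarRing.norm_mem_unitary_mul _ (mul_mem ha' hb')]
    · rw [CStarRing.norm_mem_unitary_mul _ (mul_mem (mul_mem ha' hb') hc')]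
  have hmem : ∀ W : SU3, (W : Matrix (Fin 3) (Fin 3) ℂ) ∈ unitary (Matrix (Fin 3) (Fin 3) ℂ) :=
    fun W => W.2.1
  have hlink : ∀ e' : Edge 4 L,
      ‖((Function.update U e g e' : SU3) : Matrix (Fin 3) (Fin 3) ℂ) -
          (Function.update U e g' e' : SU3)‖ ≤ ‖(g : Matrix (Fin 3) (Fin 3) ℂ) - (g' : SU3)‖ := by
    intro e'
    by_cases h : e' = e
    · subst h
      rw [Function.update_self, Function.update_self]
    · rw [Function.update_of_ne h, Function.update_of_ne h, sub_self, norm_zero]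
      exact norm_nonneg _
  simp only [fundamentalRep_apply, plaquetteHolonomy, Submonoid.coe_mul, ← Matrix.star_eq_inv,
    Matrix.specialUnitaryGroup.coe_star]
  refine (htel (hmem _) (Unitary.star_mem (hmem _)) (Unitary.star_mem (hmem _)) (hmem _) (hmem _)
    (Unitary.star_mem (hmem _))).trans ?_
  rw [← star_sub, norm_star, ← star_sub, norm_star]
  linarith [hlink (x, i), hlink (x.shift i, j), hlink (x.shift j, i), hlink (x, j)]

/-- **The Wilson action is `960`-Lipschitz along the circle at one link, for every torus size**
(`|S_W(U[e ↦ A T(s) B]) - S_W(U[e ↦ A T(s') B])| ≤ K |s - s'|`; the landed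
`CircleTransport.stub_actionLipschitz` is the case `4 ≤ L`, with the same proof). -/
theorem cellAverage_actionLipschitz (T : ℝ → SU3)
    (hT : ∀ θ : ℝ, ((T θ : SU3) : Matrix (Fin 3) (Fin 3) ℂ) =
      Matrix.diagonal ![Complex.exp (θ * Complex.I), Complex.exp (-(θ * Complex.I)), 1]) :
    ∃ K : ℝ, 0 ≤ K ∧ ∀ (L : ℕ) [NeZero L]
      (U : GaugeConfig 4 L SU3) (e : Edge 4 L) (A B : SU3) (s s' : ℝ),
      |wilsonAction (fundamentalRep (Fin 3)) (Function.update U e (A * T s * B)) -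
          wilsonAction (fundamentalRep (Fin 3)) (Function.update U e (A * T s' * B))| ≤
        K * |s - s'| := by
  refine ⟨960, by norm_num, fun L _ U e A B s s' => ?_⟩
  set ρ : SU3 →* Matrix (Fin 3) (Fin 3) ℂ := fundamentalRep (Fin 3)
  -- the moved link: `‖g - g'‖ ≤ |s - s'|`
  have hg : ‖((A * T s' * B : SU3) : Matrix (Fin 3) (Fin 3) ℂ) - (A * T s * B : SU3)‖ ≤
      |s - s'| := by
    have hmul : ((A * T s' * B : SU3) : Matrix (Fin 3) (Fin 3) ℂ) - (A * T s * B : SU3) =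
        (A : Matrix (Fin 3) (Fin 3) ℂ) * ((T s' : SU3) - (T s : SU3) : Matrix (Fin 3) (Fin 3) ℂ) *
          (B : Matrix (Fin 3) (Fin 3) ℂ) := by
      simp only [Submonoid.coe_mul]
      noncomm_ring
    rw [hmul, CStarRing.norm_mul_mem_unitary _ B.2.1, CStarRing.norm_mem_unitary_mul _ A.2.1,
      abs_sub_comm]
    exact cellAverage_norm_circle_sub_le T hT s' s
  -- per-plaquette bound
  have hper : ∀ p : Plaquette 4 L,
      |plaquetteCost ρ (Function.update U e (A * T s * B)) p -
          plaquetteCost ρ (Function.update U e (A * T s' * B)) p| ≤ 12 * |s - s'| := by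
    intro p
    unfold plaquetteCost
    rw [sub_sub_sub_cancel_left]
    refine (cellAverage_abs_re_trace_sub_le _ _).trans ?_
    have h := cellAverage_norm_holonomy_update_sub_le U e (A * T s' * B) (A * T s * B) p.1
      p.2.1.1 p.2.1.2
    linarith
  -- only the `≤ 80` shadow plaquettes differ
  have hVV' : ∀ e' ∉ ({e} : Finset (Edge 4 L)),
      Function.update U e (A * T s * B) e' = Function.update U e (A * T s' * B) e' :=
    fun e' he' => by simp only [Function.update_of_ne (Finset.notMem_singleton.1 he')]
  have hcard : ((Finset.univ.filter fun p : Plaquette 4 L => p.1 ∈ edgeShadow {e}).card : ℝ) ≤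
      80 := by
    have hset : Finset.univ.filter (fun p : Plaquette 4 L => p.1 ∈ edgeShadow {e}) =
        edgeShadow {e} ×ˢ Finset.univ := by
      ext p; simp
    have h1 : (edgeShadow ({e} : Finset (Edge 4 L))).card ≤ 5 := by
      simpa using card_edgeShadow_le ({e} : Finset (Edge 4 L))
    have h2 : Fintype.card {q : Fin 4 × Fin 4 // q.1 < q.2} ≤ 16 :=
      (Fintype.card_subtype_le _).trans (by simp)
    rw [hset, Finset.card_product, Finset.card_univ]
    exact_mod_cast (Nat.mul_le_mul h1 h2).trans (by norm_num)
  rw [wilsonAction_eq_shadowAction_add_bulkAction ρ (edgeShadow {e}),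
    wilsonAction_eq_shadowAction_add_bulkAction ρ (edgeShadow {e}) (Function.update U e _),
    bulkAction_congr ρ hVV', add_sub_add_right_eq_sub]
  unfold shadowAction
  rw [← Finset.sum_sub_distrib]
  refine (Finset.abs_sum_le_sum_abs _ _).trans ((Finset.sum_le_sum fun p _ => hper p).trans ?_)
  rw [Finset.sum_const, nsmul_eq_mul]
  nlinarith [abs_nonneg (s - s')]

/-- The glueing map `(U, V) ↦ (e ↦ if c e then V e else U e)` is continuous. -/
theorem cellAverage_continuous_glue {L : ℕ} (c : Edge 4 L → Prop) [DecidablePred c] :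
    Continuous fun p : GaugeConfig 4 L SU3 × GaugeConfig 4 L SU3 =>
      (fun e => if c e then p.2 e else p.1 e : GaugeConfig 4 L SU3) := by
  refine continuous_pi fun e => ?_
  by_cases h : c e
  · simp only [if_pos h]
    exact (continuous_apply e).comp continuous_snd
  · simp only [if_neg h]
    exact (continuous_apply e).comp continuous_fst

/-- **Abstract engine.**  Let `π` be a probability measure on a compact metrisable space `X` and
`gl : X → X → X` a continuous glueing with `(gl)_* (π ⊗ π) = π`.  If a continuous weight `w ≥ 0`
satisfies `w (gl U V) ≤ A ∫_V' w (gl U V') dπ` for all `U, V`, and the fibre averages of a continuous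
`g ≥ 0` are all `≤ M`, then `∫ g w dπ ≤ A M ∫ w dπ` (`∫ F dπ = ∫_U ∫_V F (gl U V)` by `integral_map` and
`integral_prod`; bound the inner integral fibrewise). -/
theorem cellAverage_abstract {X : Type*} [TopologicalSpace X] [CompactSpace X]
    [MeasurableSpace X] [BorelSpace X] [SecondCountableTopology X]
    (π : Measure X) [IsProbabilityMeasure π] (gl : X → X → X)
    (hgl : Continuous fun p : X × X => gl p.1 p.2)
    (hmap : (π.prod π).map (fun p : X × X => gl p.1 p.2) = π) (w g : X → ℝ) (hw : Continuous w)
    (hw0 : ∀ x, 0 ≤ w x) (hg : Continuous g) (hg0 : ∀ x, 0 ≤ g x) {A M : ℝ} (hA : 0 ≤ A)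
    (hdom : ∀ U V, w (gl U V) ≤ A * ∫ V', w (gl U V') ∂π)
    (hM : ∀ U, ∫ V, g (gl U V) ∂π ≤ M) :
    ∫ x, g x * w x ∂π ≤ A * M * ∫ x, w x ∂π := by
  -- iterated integrals along the glueing
  have key : ∀ F : X → ℝ, Continuous F →
      Integrable (fun p : X × X => F (gl p.1 p.2)) (π.prod π) ∧
        ∫ x, F x ∂π = ∫ U, ∫ V, F (gl U V) ∂π ∂π := by
    intro F hF
    have hint : Integrable (fun p : X × X => F (gl p.1 p.2)) (π.prod π) :=
      (hF.comp hgl).integrable_of_hasCompactSupport (HasCompactSupport.of_compactSpace _)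
    refine ⟨hint, ?_⟩
    calc ∫ x, F x ∂π = ∫ x, F x ∂((π.prod π).map fun p : X × X => gl p.1 p.2) := by rw [hmap]
      _ = ∫ p, F (gl p.1 p.2) ∂(π.prod π) :=
          integral_map hgl.measurable.aemeasurable hF.aestronglyMeasurable
      _ = ∫ U, ∫ V, F (gl U V) ∂π ∂π := integral_prod _ hint
  obtain ⟨hint_gw, hgw⟩ := key (fun x => g x * w x) (hg.mul hw)
  obtain ⟨hint_w, hw_it⟩ := key w hw
  have hglU : ∀ U : X, Continuous fun V : X => gl U V := fun U =>
    hgl.comp (Continuous.prodMk_right U)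
  -- the inner bound on each fibre
  have hinner : ∀ U : X,
      ∫ V, g (gl U V) * w (gl U V) ∂π ≤ A * M * ∫ V, w (gl U V) ∂π := by
    intro U
    have hZU0 : 0 ≤ ∫ V, w (gl U V) ∂π := integral_nonneg fun V => hw0 _
    calc ∫ V, g (gl U V) * w (gl U V) ∂π
        ≤ ∫ V, g (gl U V) * (A * ∫ V', w (gl U V') ∂π) ∂π := by
          refine integral_mono_of_nonneg (ae_of_all _ fun V => mul_nonneg (hg0 _) (hw0 _)) ?_
            (ae_of_all _ fun V => mul_le_mul_of_nonneg_left (hdom U V) (hg0 _))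
          exact ((hg.comp (hglU U)).integrable_of_hasCompactSupport
            (HasCompactSupport.of_compactSpace _)).mul_const _
      _ = (A * ∫ V', w (gl U V') ∂π) * ∫ V, g (gl U V) ∂π := by
          rw [integral_mul_const, mul_comm]
      _ ≤ (A * ∫ V', w (gl U V') ∂π) * M := mul_le_mul_of_nonneg_left (hM U) (mul_nonneg hA hZU0)
      _ = A * M * ∫ V, w (gl U V) ∂π := by ring
  rw [hgw, hw_it]
  calc ∫ U, ∫ V, g (gl U V) * w (gl U V) ∂π ∂π ≤ ∫ U, A * M * ∫ V, w (gl U V) ∂π ∂π :=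
        integral_mono hint_gw.integral_prod_left (hint_w.integral_prod_left.const_mul _) hinner
    _ = A * M * ∫ U, ∫ V, w (gl U V) ∂π ∂π := integral_const_mul _ _

/-- `(1 + β)^p ≤ 2^p (1 + β^p)` for `β ≥ 1`, `p ≥ 0` (real powers): `(1+β)^p ≤ (2β)^p = 2^p β^p`. -/
theorem cellAverage_one_add_rpow_le {β p : ℝ} (hβ : 1 ≤ β) (hp : 0 ≤ p) :
    (1 + β) ^ p ≤ 2 ^ p * (1 + β ^ p) := by
  have hβ0 : 0 ≤ β := by linarith
  calc (1 + β) ^ p ≤ (2 * β) ^ p := Real.rpow_le_rpow (by linarith) (by linarith) hp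
    _ = 2 ^ p * β ^ p := Real.mul_rpow (by norm_num) hβ0
    _ ≤ 2 ^ p * (1 + β ^ p) := by
        gcongr
        exact le_add_of_nonneg_left zero_le_one

/-- **Stub `cellAverageBound` (conditional expectation given the exterior ≤ polynomial-in-β × Haar cell
average).**  Using the glueing identity (`stub_glueHaar`, landed) and the abstract untilt (`stub_untilt`,
landed), for every cube radius `R` there are `C > 0`, `p ≥ 0` such that for all `β ≥ 1`, all tori `L ≥ 2`, all sites
`x` and all continuous `g ≥ 0`: if the Haar average of `g` over the links based in the cell `x + box 4 R`
(glued into an arbitrary exterior `U`) is `≤ M` for EVERY `U`, then `∫ g dμ_{β,L} ≤ C (1 + β^p) M`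
(`C = C₀ 2^{p₀}`, `p = p₀`, where `C₀, p₀` are the untilt constants at `n = 4(2R+1)^4`, `K = 960`). -/
theorem stub_cellAverageBound (R : ℕ) :
    ∃ C p : ℝ, 0 < C ∧ 0 ≤ p ∧ ∀ β : ℝ, 1 ≤ β → ∀ (L : ℕ) [NeZero L], 2 ≤ L →
      ∀ (x : TorusSite 4 L) (g : GaugeConfig 4 L SU3 → ℝ), Continuous g → (∀ U, 0 ≤ g U) →
      ∀ M : ℝ,
        (∀ U : GaugeConfig 4 L SU3,
          ∫ V, g (fun e => if (∃ y ∈ box 4 R, e.1 = x + Torus.proj L y) then V e else U e)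
            ∂(Measure.pi fun _ : Edge 4 L => haarProbability SU3) ≤ M) →
        ∫ U, g U ∂(wilsonMeasure (fundamentalRep (Fin 3)) β : Measure (GaugeConfig 4 L SU3)) ≤
          C * (1 + β ^ p) * M := by
  have hglue := @stub_glueHaar
  have huntilt := @stub_untilt
  obtain ⟨T, hT⟩ := cellAverage_exists_diagCircle
  obtain ⟨K, -, hK⟩ := cellAverage_actionLipschitz T hT
  obtain ⟨C₀, p₀, hC₀, hp₀, hU⟩ := huntilt T hT (4 * (2 * R + 1) ^ 4) K
  refine ⟨C₀ * 2 ^ p₀, p₀, by positivity, hp₀, ?_⟩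
  intro β hβ L _ _hL x g hg hg0 M hM
  have hβ0 : (0 : ℝ) ≤ β := by linarith
  have hρ : Continuous (fundamentalRep (Fin 3)) := continuous_fundamentalRep (Fin 3)
  have hS : Continuous (wilsonAction (d := 4) (L := L) (G := SU3) (fundamentalRep (Fin 3))) :=
    continuous_wilsonAction_of_continuous _ hρ
  have hglc := cellAverage_continuous_glue (L := L) fun e : Edge 4 L =>
    ∃ y ∈ box 4 R, e.1 = x + Torus.proj L y
  -- Step 2: the untilt applied to the glued action of the cell with frozen exterior `U`
  have hSU : ∀ U V : GaugeConfig 4 L SU3,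
      Real.exp (-(β * wilsonAction (fundamentalRep (Fin 3))
        (fun e => if (∃ y ∈ box 4 R, e.1 = x + Torus.proj L y) then V e else U e))) ≤
      C₀ * (1 + β) ^ p₀ * ∫ V', Real.exp (-(β * wilsonAction (fundamentalRep (Fin 3))
        (fun e => if (∃ y ∈ box 4 R, e.1 = x + Torus.proj L y) then V' e else U e)))
        ∂(Measure.pi fun _ : Edge 4 L => haarProbability SU3) := by
    intro U
    -- the glued action as a function of the cell configuration
    set SU : GaugeConfig 4 L SU3 → ℝ := fun W => wilsonAction (fundamentalRep (Fin 3))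
      (fun e => if (∃ y ∈ box 4 R, e.1 = x + Torus.proj L y) then W e else U e) with hSU
    -- the listed cell coordinates `(x + y, μ)`, `y ∈ box 4 R`
    set r : ↥(box 4 R) × Fin 4 → Edge 4 L := fun q => (x + Torus.proj L (q.1 : Site 4), q.2) with hr
    have hrmem : ∀ q : ↥(box 4 R) × Fin 4, ∃ y ∈ box 4 R, (r q).1 = x + Torus.proj L y :=
      fun q => ⟨q.1, q.1.2, rfl⟩
    have hcard : Fintype.card (↥(box 4 R) × Fin 4) ≤ 4 * (2 * R + 1) ^ 4 := by
      rw [Fintype.card_prod, Fintype.card_coe, card_box, Fintype.card_fin, mul_comm]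
    -- dependence on the listed coordinates only
    have hdep : ∀ W W' : GaugeConfig 4 L SU3, (∀ q, W (r q) = W' (r q)) → SU W = SU W' := by
      intro W W' hWW'
      simp only [hSU]
      congr 1
      funext e
      by_cases he : ∃ y ∈ box 4 R, e.1 = x + Torus.proj L y
      · rw [if_pos he, if_pos he]
        obtain ⟨y, hy, hye⟩ := he
        rw [show e = r (⟨y, hy⟩, e.2) from Prod.ext hye rfl]
        exact hWW' _
      · rw [if_neg he, if_neg he]
    -- the glue commutes with updating a cell link, so `SU` inherits the Lipschitz bound
    have hupd : ∀ (W : GaugeConfig 4 L SU3) (q : ↥(box 4 R) × Fin 4) (h : SU3),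
        (fun e => if (∃ y ∈ box 4 R, e.1 = x + Torus.proj L y) then Function.update W (r q) h e
          else U e) =
        Function.update
          (fun e => if (∃ y ∈ box 4 R, e.1 = x + Torus.proj L y) then W e else U e) (r q) h := by
      intro W q h
      funext e
      by_cases he : e = r q
      · subst he
        rw [Function.update_self, Function.update_self, if_pos (hrmem q)]
      · rw [Function.update_of_ne he, Function.update_of_ne he]
    have hlip : ∀ (W : GaugeConfig 4 L SU3) (q : ↥(box 4 R) × Fin 4) (A B : SU3) (s s' : ℝ),
        |SU (Function.update W (r q) (A * T s * B)) - SU (Function.update W (r q) (A * T s' * B))| ≤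
          K * |s - s'| := by
      intro W q A B s s'
      simp only [hSU]
      rw [hupd, hupd]
      exact hK L _ (r q) A B s s'
    exact hU (Edge 4 L) (↥(box 4 R) × Fin 4) r hcard SU
      (hS.comp (hglc.comp (Continuous.prodMk_right U))) hdep hlip β hβ0
  -- Step 0: `∫ g dμ = (∫ g w dπ) / Z`, `Z > 0`
  have h0 := wilsonExpectation_eq_integral_div (d := 4) (L := L) (fundamentalRep (Fin 3)) hρ β g
  have hZ := integral_exp_neg_mul_wilsonAction_pos (d := 4) (L := L) (G := SU3)
    (fundamentalRep (Fin 3)) hρ β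
  simp only [neg_mul] at h0 hZ
  change wilsonExpectation (fundamentalRep (Fin 3)) β g ≤ _
  rw [h0, div_le_iff₀ hZ]
  -- Steps 1, 3: the abstract engine (glueing identity from `hglue`)
  have hM0 : 0 ≤ M := le_trans (integral_nonneg fun V => hg0 _) (hM 1)
  have key := cellAverage_abstract (Measure.pi fun _ : Edge 4 L => haarProbability SU3)
    (fun U V : GaugeConfig 4 L SU3 =>
      (fun e => if (∃ y ∈ box 4 R, e.1 = x + Torus.proj L y) then V e else U e : GaugeConfig 4 L SU3))
    hglc (hglue (haarProbability SU3) {e : Edge 4 L | ∃ y ∈ box 4 R, e.1 = x + Torus.proj L y})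
    (fun U => Real.exp (-(β * wilsonAction (fundamentalRep (Fin 3)) U))) g
    ((continuous_const.mul hS).neg.rexp) (fun _ => (Real.exp_pos _).le) hg hg0
    (A := C₀ * (1 + β) ^ p₀) (M := M) (by positivity) hSU hM
  -- Step 4: `(1 + β)^{p₀} ≤ 2^{p₀} (1 + β^{p₀})`
  have hpow : C₀ * (1 + β) ^ p₀ ≤ C₀ * 2 ^ p₀ * (1 + β ^ p₀) := by
    rw [mul_assoc]
    exact mul_le_mul_of_nonneg_left (cellAverage_one_add_rpow_le hβ hp₀) hC₀.le
  exact key.trans (mul_le_mul_of_nonneg_right (mul_le_mul_of_nonneg_right hpow hM0) hZ.le)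

end Summit.QuantumFields.QCD.Cruxes.WegnerEstimate.ResolventCell

end
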